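import Literature.NumberTheory.LFunctions.UniformClassGroupZeroSum
import Literature.NumberTheory.LFunctions.ClassGroupExplicitFormula
import Literature.NumberTheory.LFunctions.UniformClassGroupPNTGeneralDegreeInputs
import HarnessLib

/-!
# The zero sum of ONE class group `L`-function over its NON-REAL zeros, against the
# Thorner–Zaman weight, from an abstract log-free density bound and a zero-free region

Topic `Summits/QuantumAdvantage/QuantumAdvantage/Theorems`, helper for the stub
`stub_perCharacterDeficit_of_density` (line `subgroup-orthogonality-escape`, crux
`DegreeOnePrimesEscape`, stmt-QuantumAdvantage-11543).

This is the single-character, general-degree twin of the tree's family file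
`UniformClassGroupZeroSum.lean` (imaginary quadratic fields, whole family `Ĉl_K`): for a number
field `K` of degree `n > 1`, ONE character `χ ≠ 1` of `Cl_K`, the weight `g = tzTest (log x) ε`
(`x^{−ν} ≤ ε ≤ 1`) and its Laplace transform `F`, the zero terms of the explicit formula over the
NON-REAL non-trivial zeros satisfy

  `Σ_{ρ ∈ u, Im ρ ≠ 0} m(ρ) ‖F(−ρ)‖ ≤ A₀ x (e^{−cL/(4a log Q)} + e^{−√(cL/4)}) + A₀ x^{1−ν}`

(`zeroSum_nonreal_le`), `Q = condQn K`, `L = log x ≥ a₀ log Q`, GIVEN (as hypotheses on `χ`)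
the zero-free region `β ≤ 1 − c/(a log Q + log(|γ| + 4))` for the non-real zeros and the log-free
density bound `Σ_{|γ| ≤ T, β ≥ α} m ≤ D e^{b(a log Q + log(T + 4))(1 − α)}`. The real zeros are
simply EXCLUDED (the set `Exc` of `EntireEF.sum_zeroTerm_le`): in the one-sided application they
are dropped by sign. Ingredients: `EntireEF.sum_zeroTerm_le`,
`LinnikZeroSum.sum_rpow_div_le_of_density_zfr`, `sum_mult_le_of_window`, `junk_le` (all in tree).
-/

noncomputable section

open Complex Real MeasureTheory Set Filter Topology
open scoped NumberField nonZeroDivisors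
open Literature.NumberTheory.LFunctions Literature.NumberTheory.LFunctions.NumberField
  Literature.NumberTheory.LFunctions.EntireEF Literature.NumberTheory.LFunctions.TZWeight

namespace Summit.QuantumAdvantage.QuantumAdvantage.Theorems.DegreeOnePrimesEscape

/-! ### The finite part, one entire function -/

/-- **The finite part of the zero sum over the non-real zeros of one entire function** (abstract
Thorner–Zaman Lemmas 4.5–4.6): for `f` entire, non-zero at `c₀`, with the zero-free region
`β ≤ 1 − c_Z/(𝓠 + log(|γ| + 4))` for its NON-REAL non-trivial zeros and the log-free density
bound `Σ_{|γ| ≤ T, α ≤ β} m ≤ D₀ e^{b(𝓠 + log(T + 4))(1−α)}`, and `e^{b(𝓠 + log(2T₁+4))} ≤ √x`: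
`Σ_{|γ| ≤ T₁, γ ≠ 0, β ≥ 1/4} m x^{β−1}/max(1,|γ|) ≤ 64 D₀ (e^{−c_Z L/(4𝓠)} + e^{−√(c_Z L/4)})`. -/
theorem finitePart_nonreal_le {f : ℂ → ℂ} (hf : Differentiable ℂ f) {c₀ : ℂ} (hc₀ : f c₀ ≠ 0)
    {x 𝓠 c_Z b D₀ T₁ : ℝ} (hx : 1 < x) (h𝓠 : 1 ≤ 𝓠) (hcZ : 0 < c_Z) (hb : 0 ≤ b) (hD₀ : 0 ≤ D₀)
    (hT₁ : 1 ≤ T₁)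
    (hzfr : ∀ ρ : ℂ, f ρ = 0 → 0 < ρ.re → ρ.re < 1 → ρ.im ≠ 0 →
      ρ.re ≤ 1 - c_Z / (𝓠 + Real.log (|ρ.im| + 4)))
    (hdens : ∀ T : ℝ, 1 ≤ T → ∀ u : Finset ℂ,
      (∀ ρ ∈ u, f ρ = 0 ∧ 1 / 4 ≤ ρ.re ∧ ρ.re < 1 ∧ |ρ.im| ≤ T) → ∀ α : ℝ, α ≤ 1 →
        ∑ ρ ∈ u with α ≤ ρ.re, (analyticOrderNatAt f ρ : ℝ) ≤
          D₀ * Real.exp (b * (𝓠 + Real.log (T + 4))) ^ (1 - α))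
    (hrange : Real.exp (b * (𝓠 + Real.log (2 * T₁ + 4))) ≤ x ^ ((1 : ℝ) / 2)) :
    ∑ ρ ∈ (finite_nontrivialZeros_inter hf hc₀ T₁).toFinset with (ρ.im ≠ 0 ∧ 1 / 4 ≤ ρ.re),
        (analyticOrderNatAt f ρ : ℝ) * x ^ (ρ.re - 1) / max 1 |ρ.im| ≤
      64 * D₀ * (Real.exp (-(c_Z * Real.log x / (4 * 𝓠))) +
        Real.exp (-Real.sqrt (c_Z * Real.log x / 4))) := by
  classical
  set s := (finite_nontrivialZeros_inter hf hc₀ T₁).toFinset.filter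
    (fun ρ ↦ ρ.im ≠ 0 ∧ 1 / 4 ≤ ρ.re) with hs
  have hmem : ∀ ρ ∈ s, (f ρ = 0 ∧ 0 < ρ.re ∧ ρ.re < 1) ∧ |ρ.im| ≤ T₁ ∧ ρ.im ≠ 0 ∧ 1 / 4 ≤ ρ.re := by
    intro ρ hρ
    rw [hs, Finset.mem_filter, Set.Finite.mem_toFinset] at hρ
    exact ⟨hρ.1.1, hρ.1.2, hρ.2.1, hρ.2.2⟩
  refine LinnikZeroSum.sum_rpow_div_le_of_density_zfr s (fun ρ ↦ ρ.re) (fun ρ ↦ ρ.im)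
    (fun ρ ↦ (analyticOrderNatAt f ρ : ℝ)) hx h𝓠 hcZ hb hD₀ hT₁ (fun _ _ ↦ Nat.cast_nonneg _)
    (fun ρ hρ ↦ (hmem ρ hρ).2.1) (fun ρ hρ ↦ ?_) (fun T α hT hα ↦ ?_) hrange
  · obtain ⟨⟨h0, h1, h2⟩, -, him, -⟩ := hmem ρ hρ
    exact hzfr ρ h0 h1 h2 him
  · have h := hdens T hT (s.filter (fun ρ ↦ |ρ.im| ≤ T)) (fun ρ hρ ↦ ?_) α hα
    · rw [Finset.filter_filter] at h
      exact h
    · rw [Finset.mem_filter] at hρ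
      obtain ⟨⟨h0, -, h2⟩, -, -, h14⟩ := hmem ρ hρ.1
      exact ⟨h0, h14, h2, hρ.2⟩

/-! ### One function against the weight: the non-real zeros -/

/-- **The zero terms over the non-real zeros of one function against the TZ weight**
(`EntireEF.sum_zeroTerm_le` with the real zeros of the truncation excluded): for a finite set `u`
of non-trivial zeros, `Σ_{ρ ∈ u, γ ≠ 0} m ‖F(−ρ)‖ ≤ e^ε x (8M S + J)` with
`S = Σ_{|γ| ≤ T₁, γ ≠ 0, β ≥ 1/4} m x^{β−1}/max(1,|γ|)` and the junk
`J = (L + ε + 8M) x^{−3/4} Σ_{|γ| ≤ T₁} m + (2M/ε) T₁^{−1/2} W (c₁A + c₂)`. -/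
theorem sum_nonreal_zeroTerm_le {f : ℂ → ℂ} (hf : Differentiable ℂ f) {c₀ : ℂ} (hc₀ : f c₀ ≠ 0)
    {W A : ℝ} (hW : 0 ≤ W) (hA : 0 ≤ A)
    (hwin : ∀ (τ : ℝ) (P : Finset ℂ), (∀ ρ ∈ P, f ρ = 0 ∧ 0 < ρ.re ∧ ρ.re < 1 ∧ |ρ.im - τ| ≤ 1 / 2) →
      ∑ ρ ∈ P, (analyticOrderNatAt f ρ : ℝ) ≤ W * (A + Real.log (|τ| + 4)))
    {M : ℝ} (hM : ∀ y : ℝ, |iteratedDeriv 1 Real.smoothTransition y| ≤ M ∧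
      |iteratedDeriv 2 Real.smoothTransition y| ≤ M)
    {x ε : ℝ} (hx : 1 < x) (hε : 0 < ε) (hεL : ε < Real.log x / 2) {T₁ : ℝ} (hT₁ : 1 ≤ T₁)
    (u : Finset ℂ) (hu : ∀ ρ ∈ u, f ρ = 0 ∧ 0 < ρ.re ∧ ρ.re < 1) :
    ∑ ρ ∈ u with ρ.im ≠ 0, (analyticOrderNatAt f ρ : ℝ) * ‖fordLaplace (tzTest (Real.log x) ε) (-ρ)‖ ≤
      Real.exp ε * x *
        (8 * M * ∑ ρ ∈ (finite_nontrivialZeros_inter hf hc₀ T₁).toFinset with (ρ.im ≠ 0 ∧ 1 / 4 ≤ ρ.re),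
            (analyticOrderNatAt f ρ : ℝ) * x ^ (ρ.re - 1) / max 1 |ρ.im| +
          ((Real.log x + ε + 8 * M) * x ^ (-(3 : ℝ) / 4) *
              ∑ ρ ∈ (finite_nontrivialZeros_inter hf hc₀ T₁).toFinset, (analyticOrderNatAt f ρ : ℝ) +
            (2 * M / ε) * T₁ ^ (-((1 : ℝ) / 2)) * (W * (tailConst₁ * A + tailConst₂)))) := by
  classical
  have hx0 : 0 < x := by linarith
  set Lx : ℝ := Real.log x with hLx
  have hL0 : 0 < Lx := Real.log_pos hx
  have hexpL : Real.exp Lx = x := by rw [hLx, Real.exp_log hx0]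
  have hdp : DecidablePred (· ∈ nontrivialZeros f) := fun _ ↦ Classical.propDecidable _
  set Fin := (finite_nontrivialZeros_inter hf hc₀ T₁).toFinset with hFin
  set Exc : Finset ℂ := (Fin ∪ u).filter (fun ρ ↦ ρ.im = 0) with hExc
  set u' : Finset (nontrivialZeros f) :=
    ((u.filter (fun ρ ↦ ρ.im ≠ 0)).subtype (· ∈ nontrivialZeros f)) with hu'
  have key := sum_zeroTerm_le hf hc₀ hW hA hwin hM hL0 hε hεL hT₁ Exc u'
  -- the left side
  have h1 : u'.filter (fun ρ' : nontrivialZeros f ↦ (ρ' : ℂ) ∉ Exc) = u' := by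
    refine Finset.filter_true_of_mem fun ρ' hρ' ↦ ?_
    rw [hu', Finset.mem_subtype, Finset.mem_filter] at hρ'
    rw [hExc, Finset.mem_filter, not_and_or]
    exact Or.inr hρ'.2
  rw [h1] at key
  have hLHS : ∑ ρ' ∈ u', (analyticOrderNatAt f (ρ' : ℂ) : ℝ) * ‖fordLaplace (tzTest Lx ε) (-(ρ' : ℂ))‖ =
      ∑ ρ ∈ u with ρ.im ≠ 0, (analyticOrderNatAt f ρ : ℝ) * ‖fordLaplace (tzTest Lx ε) (-ρ)‖ := by
    rw [hu', Finset.sum_subtype_of_mem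
      (fun ρ : ℂ ↦ (analyticOrderNatAt f ρ : ℝ) * ‖fordLaplace (tzTest Lx ε) (-ρ)‖)]
    intro ρ hρ
    rw [Finset.mem_filter] at hρ
    exact hu ρ hρ.1
  rw [hLHS] at key
  refine key.trans ?_
  rw [hexpL]
  refine mul_le_mul_of_nonneg_left ?_ (by positivity)
  rw [add_assoc]
  refine add_le_add ?_ le_rfl
  -- the finite part: the filter `ρ ∉ Exc` is `ρ.im ≠ 0` on `Fin`
  have hM0 : 0 ≤ M := le_trans (abs_nonneg _) (hM 0).1
  refine mul_le_mul_of_nonneg_left (le_of_eq ?_) (by positivity)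
  refine Finset.sum_congr (Finset.filter_congr fun ρ hρ ↦ ?_) fun _ _ ↦ rfl
  rw [hExc, Finset.mem_filter, not_and_or]
  constructor
  · rintro ⟨h | h, h14⟩
    · exact absurd (Finset.mem_union_left _ hρ) h
    · exact ⟨h, h14⟩
  · rintro ⟨h, h14⟩; exact ⟨Or.inr h, h14⟩

/-! ### The class group `L`-function of one non-trivial character -/

/-- The window data of `L₀(·,χ)` in general degree: `A = log|d_K| + 3n ≤ 4Q − 1`, `Q = condQn K`
(`log|d_K| ≤ |d_K| − 1 ≤ Q − 1`, `n ≤ Q`). -/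
theorem windowConst_le_condQn (K : Type) [Field K] [NumberField K] :
    Real.log ((NumberField.discr K).natAbs : ℝ) + 3 * Module.finrank ℚ K ≤
      4 * ThornerZaman.condQn K := by
  have hd1 : (1 : ℝ) ≤ ((NumberField.discr K).natAbs : ℝ) := by
    have h1 : 1 ≤ (NumberField.discr K).natAbs :=
      Nat.one_le_iff_ne_zero.2 (Int.natAbs_ne_zero.2 (NumberField.discr_ne_zero K))
    exact_mod_cast h1
  have hlog := Real.log_le_sub_one_of_pos (by linarith : (0:ℝ) < ((NumberField.discr K).natAbs : ℝ))
  have hn := ThornerZaman.finrank_le_condQn (K := K)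
  have hdQ : ((NumberField.discr K).natAbs : ℝ) ≤ ThornerZaman.condQn K := by
    rw [ThornerZaman.condQn, Nat.cast_natAbs, Int.cast_abs]
    have hn1 : (1 : ℝ) ≤ (Module.finrank ℚ K : ℝ) ^ Module.finrank ℚ K := by
      have : (1 : ℝ) ≤ Module.finrank ℚ K := by
        exact_mod_cast Module.finrank_pos (R := ℚ) (M := K)
      exact one_le_pow₀ this
    nlinarith [abs_nonneg ((NumberField.discr K : ℝ))]
  linarith

set_option maxHeartbeats 800000 in
/-- **The zero sum of `L₀(·,χ)` over its non-real zeros, from density + ZFR** (general degree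
`n > 1`, one character `χ ≠ 1`; the analogue of Thorner–Zaman 2019 §4.3 for a single `L`-function
with the real zeros excluded). With `Q = condQn K`, `L = log x`: there are `ν ∈ (0, 1/64]`,
`a₀ ≥ 1`, `A₀ > 0` depending only on `n, b, D, a` such that for every `c > 0`, every `K` of degree
`n`, every `χ ≠ 1` whose non-real zeros obey `β ≤ 1 − c/(a log Q + log(|γ| + 4))` and whose zeros
obey the density bound `Σ_{|γ| ≤ T, β ≥ α} m ≤ D e^{b(a log Q + log(T+4))(1−α)}` (`T ≥ 1`,
`α ≤ 1`), every `x ≥ Q^{a₀}`, `x^{−ν} ≤ ε ≤ 1` and every finite set `u` of non-trivial zeros: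
`Σ_{ρ ∈ u, γ ≠ 0} m(ρ)‖F(−ρ)‖ ≤ A₀ x (e^{−cL/(4a log Q)} + e^{−√(cL/4)}) + A₀ x^{1−ν}`. -/
theorem zeroSum_nonreal_le (n : ℕ) (hn : 1 < n) {b D a : ℝ} (hb : 0 < b) (hD : 0 < D) (ha : 1 ≤ a) :
    ∃ ν a₀ A₀ : ℝ, 0 < ν ∧ ν ≤ 1 / 64 ∧ 1 ≤ a₀ ∧ 0 < A₀ ∧
    ∀ (c : ℝ), 0 < c → ∀ (K : Type) [Field K] [NumberField K], Module.finrank ℚ K = n →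
    ∀ χ : ClassGroup (𝓞 K) →* ℂˣ, χ ≠ 1 →
      (∀ ρ : ℂ, classGroupLFunction₀ K χ ρ = 0 → 0 < ρ.re → ρ.re < 1 → ρ.im ≠ 0 →
          ρ.re ≤ 1 - c / (a * Real.log (ThornerZaman.condQn K) + Real.log (|ρ.im| + 4))) →
      (∀ T : ℝ, 1 ≤ T → ∀ u : Finset ℂ,
        (∀ ρ ∈ u, classGroupLFunction₀ K χ ρ = 0 ∧ 1 / 4 ≤ ρ.re ∧ ρ.re < 1 ∧ |ρ.im| ≤ T) →
        ∀ α : ℝ, α ≤ 1 →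
          ∑ ρ ∈ u with α ≤ ρ.re, (analyticOrderNatAt (classGroupLFunction₀ K χ) ρ : ℝ) ≤
            D * Real.exp (b * (a * Real.log (ThornerZaman.condQn K) + Real.log (T + 4))) ^ (1 - α)) →
      ∀ x : ℝ, ThornerZaman.condQn K ^ a₀ ≤ x → ∀ ε : ℝ, x ^ (-ν) ≤ ε → ε ≤ 1 →
      ∀ u : Finset ℂ, (∀ ρ ∈ u, classGroupLFunction₀ K χ ρ = 0 ∧ 0 < ρ.re ∧ ρ.re < 1) →
        ∑ ρ ∈ u with ρ.im ≠ 0, (analyticOrderNatAt (classGroupLFunction₀ K χ) ρ : ℝ) *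
            ‖fordLaplace (tzTest (Real.log x) ε) (-ρ)‖ ≤
          A₀ * x * (Real.exp (-(c * Real.log x / (4 * a * Real.log (ThornerZaman.condQn K)))) +
              Real.exp (-Real.sqrt (c * Real.log x / 4))) + A₀ * x ^ (1 - ν) := by
  classical
  obtain ⟨M, hM1, hM⟩ := TZWeight.exists_smoothTransition_deriv_bound
  obtain ⟨hc₁16, hc₂0⟩ := tailConst_nonneg
  set β₀ : ℝ := max b 1 with hβ₀
  have hβ₀1 : 1 ≤ β₀ := le_max_right _ _
  have hbβ₀ : b ≤ β₀ := le_max_left _ _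
  set ν : ℝ := 1 / (64 * β₀) with hν
  have hν0 : 0 < ν := by positivity
  have hν64 : ν ≤ 1 / 64 := by
    rw [hν]; exact one_div_le_one_div_of_le (by norm_num) (by nlinarith)
  set a₀ : ℝ := 400 * a * β₀ with ha₀
  set W₀ : ℝ := 512 * ((n : ℝ) + 1) with hW₀
  have hW₀0 : 0 ≤ W₀ := by positivity
  set A₁ : ℝ := 50 * W₀ * (1 / ν + 1 + 8 * M) + 2 * M * W₀ * (4 * tailConst₁ + tailConst₂) with hA₁
  have hA₁0 : 0 ≤ A₁ := by
    have : 0 ≤ M := by linarith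
    have : 0 ≤ tailConst₁ := by linarith
    positivity
  set A₀ : ℝ := Real.exp 1 * (512 * M * D + A₁) with hA₀
  refine ⟨ν, a₀, A₀, hν0, hν64, by rw [ha₀]; nlinarith, by positivity,
    fun c hc K _ _ hKn χ hχ hzfr hdens x hx ε hεν hε1 u hu ↦ ?_⟩
  -- sizes
  have hK : 1 < Module.finrank ℚ K := by rw [hKn]; exact hn
  set Q : ℝ := ThornerZaman.condQn K with hQ
  have hQ12 : (12 : ℝ) ≤ Q := ThornerZaman.twelve_le_condQn (K := K) hK
  have hQ1 : (1 : ℝ) < Q := by linarith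
  have hlog12 : (2 : ℝ) ≤ Real.log 12 := by
    rw [Real.le_log_iff_exp_le (by norm_num)]
    have := Real.exp_one_lt_d9
    have h : Real.exp 2 = Real.exp 1 * Real.exp 1 := by rw [← Real.exp_add]; norm_num
    rw [h]; nlinarith [Real.exp_pos (1:ℝ)]
  have hlogQ : 2 ≤ Real.log Q := hlog12.trans (Real.log_le_log (by norm_num) hQ12)
  have ha₀1 : (1 : ℝ) ≤ a₀ := by rw [ha₀]; nlinarith
  have hxQ : Q ≤ x := by
    have : Q ^ (1 : ℝ) ≤ Q ^ a₀ := Real.rpow_le_rpow_of_exponent_le hQ1.le ha₀1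
    rw [Real.rpow_one] at this; linarith
  have hx1 : 1 < x := by linarith
  have hx0 : 0 < x := by linarith
  set Lx : ℝ := Real.log x with hLx
  have hLQ : a₀ * Real.log Q ≤ Lx := by
    have := Real.log_le_log (by positivity) hx
    rwa [Real.log_rpow (by linarith)] at this
  have hL800 : 800 * β₀ ≤ Lx := by nlinarith
  have hL0 : 0 < Lx := by linarith
  have hε0 : 0 < ε := lt_of_lt_of_le (Real.rpow_pos_of_pos hx0 _) hεν
  have hεL : ε < Lx / 2 := by linarith
  set T₁ : ℝ := x ^ (6 * ν) with hT₁
  have hT₁1 : 1 ≤ T₁ := Real.one_le_rpow hx1.le (by positivity)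
  -- the window data (`n` general)
  set A : ℝ := Real.log ((NumberField.discr K).natAbs : ℝ) + 3 * n with hAdef
  have hAnn : 0 ≤ A := by have := Real.log_natCast_nonneg (NumberField.discr K).natAbs; positivity
  set L0 := classGroupLFunction₀ K χ with hL0def
  have hdf : Differentiable ℂ L0 := differentiable_classGroupLFunction₀ χ
  have hc₀ : L0 (2 + ((0 : ℝ) : ℂ) * I) ≠ 0 := classGroupLFunction₀_two_add_ne_zero hχ 0
  have hwin : ∀ (τ : ℝ) (P : Finset ℂ), (∀ ρ ∈ P, L0 ρ = 0 ∧ 0 < ρ.re ∧ ρ.re < 1 ∧ |ρ.im - τ| ≤ 1 / 2) →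
      ∑ ρ ∈ P, (analyticOrderNatAt L0 ρ : ℝ) ≤ W₀ * (A + Real.log (|τ| + 4)) := by
    intro τ P hP
    have := window_bound_classGroupLFunction₀ hχ τ P hP
    rw [hKn] at this
    convert this using 2
  -- (A) the per-function estimate
  set S : ℝ := ∑ ρ ∈ (finite_nontrivialZeros_inter hdf hc₀ T₁).toFinset with (ρ.im ≠ 0 ∧ 1 / 4 ≤ ρ.re),
    (analyticOrderNatAt L0 ρ : ℝ) * x ^ (ρ.re - 1) / max 1 |ρ.im| with hS
  set J : ℝ := (Lx + ε + 8 * M) * x ^ (-(3 : ℝ) / 4) * ((2 * T₁ + 3) * (W₀ * (A + Real.log (T₁ + 5)))) +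
    (2 * M / ε) * T₁ ^ (-((1 : ℝ) / 2)) * (W₀ * (tailConst₁ * A + tailConst₂)) with hJ
  have hper : ∑ ρ ∈ u with ρ.im ≠ 0, (analyticOrderNatAt L0 ρ : ℝ) * ‖fordLaplace (tzTest Lx ε) (-ρ)‖ ≤
      Real.exp ε * x * (8 * M * S + J) := by
    have key := sum_nonreal_zeroTerm_le hdf hc₀ hW₀0 hAnn hwin hM hx1 hε0 hεL hT₁1 u hu
    refine key.trans ?_
    refine mul_le_mul_of_nonneg_left (add_le_add le_rfl ?_) (by positivity)
    rw [hJ]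
    refine add_le_add (mul_le_mul_of_nonneg_left ?_ ?_) le_rfl
    · refine sum_mult_le_of_window hW₀0 hAnn hwin (by linarith) _ fun ρ hρ ↦ ?_
      rw [Set.Finite.mem_toFinset] at hρ
      exact ⟨hρ.1.1, hρ.1.2.1, hρ.1.2.2, hρ.2⟩
    · have : 0 ≤ M := by linarith
      positivity
  -- (C) the finite part by density + ZFR, `𝓠 = a log Q`
  set 𝓠 : ℝ := a * Real.log Q with h𝓠
  have h𝓠1 : 1 ≤ 𝓠 := by rw [h𝓠]; nlinarith
  have hrange : Real.exp (b * (𝓠 + Real.log (2 * T₁ + 4))) ≤ x ^ ((1 : ℝ) / 2) := by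
    rw [show x ^ ((1 : ℝ) / 2) = Real.exp (Lx / 2) by rw [hLx, Real.rpow_def_of_pos hx0]; ring_nf]
    refine Real.exp_le_exp.2 ?_
    have hT6 : Real.log (2 * T₁ + 4) ≤ 2 + 6 * ν * Lx := by
      have h1 : Real.log (2 * T₁ + 4) ≤ Real.log (6 * T₁) :=
        Real.log_le_log (by linarith only [hT₁1]) (by linarith only [hT₁1])
      rw [Real.log_mul (by norm_num) (by linarith only [hT₁1]), hT₁, Real.log_rpow hx0, ← hLx] at h1
      have h3 : Real.log 6 ≤ 2 := by
        rw [Real.log_le_iff_le_exp (by norm_num)]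
        have := Real.exp_one_gt_d9
        have h : Real.exp 2 = Real.exp 1 * Real.exp 1 := by rw [← Real.exp_add]; norm_num
        rw [h]; nlinarith only [this]
      linarith only [h1, h3]
    have hbν : b * (6 * ν * Lx) ≤ 6 / 64 * Lx := by
      have hbν' : b * ν ≤ 1 / 64 := by
        rw [hν]; rw [show b * (1 / (64 * β₀)) = b / β₀ / 64 by ring]
        have : b / β₀ ≤ 1 := (div_le_one (by positivity)).2 hbβ₀
        linarith
      have : b * (6 * ν * Lx) = 6 * (b * ν) * Lx := by ring
      rw [this]
      have := mul_le_mul_of_nonneg_right hbν' hL0.le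
      linarith only [this]
    have hb2 : b * 2 ≤ Lx / 400 := by linarith only [hbβ₀, hL800]
    have hbQ : b * 𝓠 ≤ Lx / 400 := by
      have h0Q : 0 ≤ a * Real.log Q := by nlinarith only [hlogQ, ha]
      have h1 : b * (a * Real.log Q) ≤ β₀ * (a * Real.log Q) := mul_le_mul_of_nonneg_right hbβ₀ h0Q
      have h2' : β₀ * (a * Real.log Q) = (a₀ * Real.log Q) / 400 := by rw [ha₀]; ring
      rw [h2'] at h1
      have h3 : (a₀ * Real.log Q) / 400 ≤ Lx / 400 := by linarith only [hLQ]
      rw [h𝓠]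
      linarith only [h1, h3]
    have h4 : b * Real.log (2 * T₁ + 4) ≤ b * 2 + b * (6 * ν * Lx) := by
      have := mul_le_mul_of_nonneg_left hT6 hb.le; linarith only [this]
    have h5 : b * (𝓠 + Real.log (2 * T₁ + 4)) = b * 𝓠 + b * Real.log (2 * T₁ + 4) := by ring
    rw [h5]
    linarith only [hbQ, h4, hbν, hb2, hL0]
  have hfin : S ≤ 64 * D * (Real.exp (-(c * Lx / (4 * 𝓠))) + Real.exp (-Real.sqrt (c * Lx / 4))) := by
    rw [hS]
    exact finitePart_nonreal_le hdf hc₀ hx1 h𝓠1 hc hb.le hD.le hT₁1 hzfr hdens hrange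
  -- (D) the junk (`h = 1`)
  have hh : (1 : ℝ) ≤ Q ^ 2 := one_le_pow₀ hQ1.le
  have hAQ : A ≤ 4 * Q := by
    have := windowConst_le_condQn K
    rw [hKn] at this
    rw [hAdef]; linarith
  have hQ3 : Q ^ 3 ≤ x ^ ν := by
    have h1 : Q ^ 3 = Real.exp (3 * Real.log Q) := by
      rw [← Real.rpow_natCast, Real.rpow_def_of_pos (by linarith)]; norm_num; ring_nf
    rw [h1, Real.rpow_def_of_pos hx0, ← hLx]
    refine Real.exp_le_exp.2 ?_
    have haν : a₀ * ν = 400 * a / 64 := by rw [ha₀, hν]; field_simp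
    have h2' : ν * (a₀ * Real.log Q) ≤ ν * Lx := mul_le_mul_of_nonneg_left hLQ hν0.le
    have h3 : ν * (a₀ * Real.log Q) = 400 * a / 64 * Real.log Q := by rw [← haν]; ring
    have h0Q : 0 ≤ Real.log Q := by linarith only [hlogQ]
    nlinarith only [h2', h3, h0Q, ha]
  have hjunk : (1 : ℝ) * J ≤ A₁ * x ^ (-ν) := by
    rw [hJ, hA₁, hT₁, hLx]
    exact junk_le hν0 hν64 hQ12 hQ3 hx1 zero_le_one hh hAnn hAQ hM1 hW₀0
      (by linarith) hc₂0 hεν hε1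
  rw [one_mul] at hjunk
  -- (E) assemble
  have hεe : Real.exp ε ≤ Real.exp 1 := Real.exp_le_exp.2 hε1
  set E : ℝ := Real.exp (-(c * Lx / (4 * 𝓠))) + Real.exp (-Real.sqrt (c * Lx / 4)) with hE
  have hE0 : 0 ≤ E := by positivity
  have hM0 : 0 ≤ M := by linarith
  have hxν : x * x ^ (-ν) = x ^ (1 - ν) := by
    rw [sub_eq_add_neg, Real.rpow_add hx0, Real.rpow_one]
  have hE' : Real.exp (-(c * Real.log x / (4 * a * Real.log (ThornerZaman.condQn K)))) +
      Real.exp (-Real.sqrt (c * Real.log x / 4)) = E := by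
    rw [hE, h𝓠, hQ, hLx]; ring_nf
  rw [hE']
  calc ∑ ρ ∈ u with ρ.im ≠ 0, (analyticOrderNatAt L0 ρ : ℝ) * ‖fordLaplace (tzTest Lx ε) (-ρ)‖
      ≤ Real.exp ε * x * (8 * M * S + J) := hper
    _ ≤ Real.exp 1 * x * (8 * M * (64 * D * E) + A₁ * x ^ (-ν)) := by
        have hin : 0 ≤ 8 * M * S + J := by
          have hS0 : 0 ≤ S := by
            rw [hS]
            exact Finset.sum_nonneg fun ρ _ ↦ div_nonneg (mul_nonneg (Nat.cast_nonneg _)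
              (Real.rpow_nonneg hx0.le _)) (by positivity)
          have hJ0 : 0 ≤ J := by
            rw [hJ]
            have : 0 ≤ Real.log (T₁ + 5) := Real.log_nonneg (by linarith)
            have ht1 : 0 ≤ tailConst₁ := by linarith
            have : 0 ≤ tailConst₁ * A + tailConst₂ := by positivity
            positivity
          positivity
        exact mul_le_mul (mul_le_mul_of_nonneg_right hεe hx0.le)
          (add_le_add (mul_le_mul_of_nonneg_left hfin (by positivity)) hjunk) hin (by positivity)
    _ = Real.exp 1 * (512 * M * D) * x * E + Real.exp 1 * A₁ * x ^ (1 - ν) := by rw [← hxν]; ring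
    _ ≤ A₀ * x * E + A₀ * x ^ (1 - ν) := by
        refine add_le_add ?_ ?_
        · rw [hA₀]
          have h0 : 0 ≤ Real.exp 1 * A₁ * (x * E) := by positivity
          nlinarith only [h0]
        · refine mul_le_mul_of_nonneg_right ?_ (Real.rpow_nonneg hx0.le _)
          rw [hA₀]
          have : 0 ≤ Real.exp 1 * (512 * M * D) := by positivity
          nlinarith only [this]

/-- Closed form of `zeroSum_nonreal_le`: the registered sub-goal of the stub `stub_perCharacterDeficit_of_density`
proved by this file. -/
theorem perCharacterDeficit_zeroSum : ∀ (n : ℕ) (hn : 1 < n) {b D a : ℝ} (hb : 0 < b) (hD : 0 < D) (ha : 1 ≤ a),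
    ∃ ν a₀ A₀ : ℝ, 0 < ν ∧ ν ≤ 1 / 64 ∧ 1 ≤ a₀ ∧ 0 < A₀ ∧
    ∀ (c : ℝ), 0 < c → ∀ (K : Type) [Field K] [NumberField K], Module.finrank ℚ K = n →
    ∀ χ : ClassGroup (𝓞 K) →* ℂˣ, χ ≠ 1 →
      (∀ ρ : ℂ, classGroupLFunction₀ K χ ρ = 0 → 0 < ρ.re → ρ.re < 1 → ρ.im ≠ 0 →
          ρ.re ≤ 1 - c / (a * Real.log (ThornerZaman.condQn K) + Real.log (|ρ.im| + 4))) →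
      (∀ T : ℝ, 1 ≤ T → ∀ u : Finset ℂ,
        (∀ ρ ∈ u, classGroupLFunction₀ K χ ρ = 0 ∧ 1 / 4 ≤ ρ.re ∧ ρ.re < 1 ∧ |ρ.im| ≤ T) →
        ∀ α : ℝ, α ≤ 1 →
          ∑ ρ ∈ u with α ≤ ρ.re, (analyticOrderNatAt (classGroupLFunction₀ K χ) ρ : ℝ) ≤
            D * Real.exp (b * (a * Real.log (ThornerZaman.condQn K) + Real.log (T + 4))) ^ (1 - α)) →
      ∀ x : ℝ, ThornerZaman.condQn K ^ a₀ ≤ x → ∀ ε : ℝ, x ^ (-ν) ≤ ε → ε ≤ 1 →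
      ∀ u : Finset ℂ, (∀ ρ ∈ u, classGroupLFunction₀ K χ ρ = 0 ∧ 0 < ρ.re ∧ ρ.re < 1) →
        ∑ ρ ∈ u with ρ.im ≠ 0, (analyticOrderNatAt (classGroupLFunction₀ K χ) ρ : ℝ) *
            ‖fordLaplace (tzTest (Real.log x) ε) (-ρ)‖ ≤
          A₀ * x * (Real.exp (-(c * Real.log x / (4 * a * Real.log (ThornerZaman.condQn K)))) +
              Real.exp (-Real.sqrt (c * Real.log x / 4))) + A₀ * x ^ (1 - ν) :=
  @zeroSum_nonreal_le

end Summit.QuantumAdvantage.QuantumAdvantage.Theorems.DegreeOnePrimesEscape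

end
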